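import Summits.BirchSwinnertonDyer.BirchSwinnertonDyer.Theorems.EisensteinPrimesMazurMCOnCellBTwistbackSubrowLineCharBalance
import Summits.BirchSwinnertonDyer.Rank1Residual.Additive.X3BranchThreeLineCertificateCharactersTwo
import HarnessLib

/-!
# Crux 3 `MazurMCOnCellB` (stmt-BirchSwinnertonDyer-19033), line `twistback` v5/v6 — the CHARACTER-FREE sub-row door for an
# EVEN kernel field discriminant (part 4 of `…LocalBalanceAtUnramifiedPlace`): quadratic Kronecker–Weber, explicit, for
# `√D` with `D = −n* ≡ 3 (mod 4)` (`χ₄ · (·/n)` modulo `4n`) and for `√(2n*)` (`χ₈ · (·/n)` modulo `8n`), `n` odd squarefree,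
# and the doors they feed

Width seat bsd-line-x2-p1-w7 (gen 2), cell `bsd-eis` (run/shared/lean/pub/bsd-eis/), 2026-08-28. HONEST FRAMING: §1 is
Gauss-sum / Dirichlet-character algebra over tree theorems (w3 g8's `exists_quadraticChar_geomSqrt_of_emod_four`, the X3
cell's `Rat.exists_sqrt_neg_one_smul_eq_chi4` / `Rat.exists_sqrt_two_smul_eq_chi8` / `chi4_three_isPrimitive` /
`chi8_three_isPrimitive` / `Rat.smul_mul_eq_changeLevel_mul`, part 1 of the twist dictionary's
`isPrimitive_changeLevel_mul_changeLevel`); §2 are CONDITIONAL doors over part 3's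
`upperPartner_at_three_of_kernelRadical_of_padicGZ` with the named facts BY NAME as there (`PublishedInputs`; Disegni 2020
Thm. 4(1), Thm. 2.4; Greenberg–Vatsal Thm. (3.11); Nakagawa–Horie–Taya — all PUBLISHED). THEOREMS ONLY (no `def`, no named
fact introduced, no `sorry`); `--supports` stmt-BirchSwinnertonDyer-19033; closes no stub by itself; nothing about any
curve is proved unconditionally; no summit statement, no Mazur main conjecture and no BSD is proved for any curve; 0 cells
/ labels / tiers move.

WHY. Part 3's character-free door `upperPartner_at_three_of_kernelDisc_of_padicGZ` covers a rational `3`-line whose kernel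
discriminant `D` (squarefree; «`σ` fixes `Φ₀` pointwise iff `σ√D = √D`») is `≡ 1 (mod 4)`. By the census of record of the
non-split A10 sub-rows (`HOME/lam-a-g16/ca/cells.tsv`, 44 cells, column `d_unr`) that is 25/44 cells (`D ∈ {5, 17, 29, 41,
65, 101}`); the others have `D = 2` (13 cells, field discriminant `8`), `D ∈ {11, 23}` (`≡ 3 (mod 4)`, 5 cells, field
discriminant `4D`) and `D = 14` (1 cell). This file adds the two missing radical lemmas and doors:

* §1 `exists_quadraticChar_geomSqrt_neg_star` — `D = −n* ≡ 3 (mod 4)` (`n` odd squarefree, `n* = (−1)^{⌊n/2⌋}n`):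
  `√D = ±√−1·√(n*)`, so `τ • √D = χ(χ_{4n} τ)·√D` for the quadratic character `χ = χ₄ · (·/n)` modulo `4n`, with
  `χ̄ = χ mod 3` PRIMITIVE and `χ(a) = χ₄(a)·J(a | n)`; `exists_quadraticChar_geomSqrt_two_mul_star` — `D = 2n*`:
  `√D = ±√2·√(n*)`, character `χ₈ · (·/n)` modulo `8n`, `χ(a) = χ₈(a)·J(a | n)` (`n = 1`: `√2`, `χ₈`, the 13 cells with
  `D = 2`). Helper `smul_geomSqrt_of_sq_eq` (a radical relation passes to the tree's chosen root `geomSqrt`).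
* §2 `upperPartner_at_three_of_kernelDisc_three_mod_four_of_padicGZ` and `upperPartner_at_three_of_kernelDisc_two_mul_of_padicGZ`
  — part 3 §4 verbatim for these `D`, the identity reading
  `1 = Σ_{S₀∖A} s_ℓ[split] + Σ_{v∈A} (0 if ℓ ∣ 4n | s_ℓ if ℓ % 3 = 2 | 2s_ℓ[χ₄(ℓ)J(ℓ | n) = 1])`, resp. with `8n` and
  `χ₈(ℓ)J(ℓ | n)` — every symbol decidable (`ZMod.χ₄`, `ZMod.χ₈`, `jacobiSym`, `sFactor`).

NOT here: `D = −2n*` (`√−2`-type, `χ₄χ₈` modulo `8n`; 1/44 cells, `235200oj1` with `D = 14 = −2·(−7)`) — the same assembly over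
a primitivity lemma for `χ₄χ₈ mod 3` not yet in the tree.

References: [IrelandRosen1990] Ch. 6 Prop. 6.3.2; [Washington1997] Ch. 2–3 (quadratic subfields of cyclotomic fields;
conductors); [Cox2013] §1.C; [GreenbergVatsal2000] §2 Prop. (2.4), p. 28, §3 Thm. (3.11), p. 43; [Disegni2020] §2.2 Thm. 2.4,
§3.2 Thm. 4; [NakagawaHorie1988] Thm. 1.
-/

set_option autoImplicit false
-- `Summit.BirchSwinnertonDyer.BirchSwinnertonDyer.…`: the summit and its single sub-problem share a name.
set_option linter.dupNamespace false

noncomputable section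

open scoped Classical NumberTheorySymbols

open NumberField IsDedekindDomain Field WeierstrassCurve DirichletCharacter
  Literature.NumberTheory.EllipticCurves Literature.NumberTheory.GaloisRepresentations
  Literature.NumberTheory.EllipticCurves.GreenbergVatsal2000
  Literature.NumberTheory.EllipticCurves.Rank1Residual Literature.NumberTheory.EllipticCurves.Rank1Residual.Typed
  Literature.NumberTheory.EllipticCurves.Disegni2020 Literature.NumberTheory.EllipticCurves.KellerYin2024
  Summit.BirchSwinnertonDyer.Rank1Residual Summit.BirchSwinnertonDyer.Rank1Residual.X2
  Summit.BirchSwinnertonDyer.Rank1Residual.Additive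
  Summit.BirchSwinnertonDyer.BirchSwinnertonDyer.Theses
  Summit.BirchSwinnertonDyer.BirchSwinnertonDyer.Theorems.EisensteinPrimesMazurMCOnCellBTwistbackTwistLineCharacters
  Summit.BirchSwinnertonDyer.BirchSwinnertonDyer.Theorems.EisensteinPrimesMazurMCOnCellBTwistbackQuadraticRadical
  Summit.BirchSwinnertonDyer.BirchSwinnertonDyer.Theorems.EisensteinPrimesMazurMCOnCellBTwistbackSubrowLineCharBalance

namespace Summit.BirchSwinnertonDyer.BirchSwinnertonDyer.Theorems.EisensteinPrimesMazurMCOnCellBTwistbackSubrowKernelDiscEven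

/-! ## §1. Quadratic Kronecker–Weber, explicit, for `√(−n*)` and `√(2n*)`, `n` odd squarefree -/

/-- A radical relation `τ • s = c_τ·s` for some `s` with `s² = d` holds for the tree's chosen root `geomSqrt d`
(`= ±s`). [folklore] -/
theorem smul_geomSqrt_of_sq_eq {d : ℚ} {s : AlgebraicClosure ℚ} (hs2 : s ^ 2 = geomSqrt d ^ 2)
    {c : absoluteGaloisGroup ℚ → AlgebraicClosure ℚ} (hs : ∀ τ : absoluteGaloisGroup ℚ, τ • s = c τ * s)
    (τ : absoluteGaloisGroup ℚ) : τ • geomSqrt d = c τ * geomSqrt d := by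
  have h : geomSqrt d = s ∨ geomSqrt d = -s := sq_eq_sq_iff_eq_or_eq_neg.mp hs2.symm
  rcases h with h | h
  · rw [h, hs τ]
  · rw [h, smul_neg, hs τ, mul_neg]

/-- **Quadratic Kronecker–Weber for `√(−n*)`, `n` odd squarefree** (`n* = (−1)^{⌊n/2⌋}·n`; `−n*` runs over the
squarefree integers `D ≡ 3 (mod 4)`, field discriminant `4D`): there is a quadratic `ℤ`-valued character `χ` modulo `4n` —
`χ(a) = χ₄(a)·J(a | n)` — whose reduction modulo `3` is PRIMITIVE, with `τ • √(−n*) = χ(χ_{4n}(τ)) • √(−n*)` for every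
`τ ∈ Γ_ℚ`. Proof: `√(−n*) = ± √−1 · √(n*)`: `χ₄` on `√−1` (X3 cell's `Rat.exists_sqrt_neg_one_smul_eq_chi4`), the Jacobi
character on `√(n*)` (w3 g8's `exists_quadraticChar_radical`), radicals and characters multiply
(`Rat.smul_mul_eq_changeLevel_mul`), primitive at the coprime levels `4`, `n`. [cite: IrelandRosen1990, Ch. 6 Prop. 6.3.2]
[cite: Washington1997, Ch. 3] [cite: Cox2013, §1.C Lemma 1.14] -/
theorem exists_quadraticChar_geomSqrt_neg_star {n : ℕ} [NeZero n] (hn : Odd n) (hsq : Squarefree n) :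
    ∃ χ : MulChar (ZMod (4 * n)) ℤ, χ.IsQuadratic ∧
      DirichletCharacter.IsPrimitive
        (χ.ringHomComp (Int.castRingHom (ZMod 3)) : DirichletCharacter (ZMod 3) (4 * n)) ∧
      (∀ a : ℕ, χ (a : ZMod (4 * n)) = ZMod.χ₄ (a : ZMod 4) * J((a : ℤ) | n)) ∧
      ∀ τ : absoluteGaloisGroup ℚ,
        τ • geomSqrt ((-((-1 : ℤ) ^ (n / 2) * n) : ℤ) : ℚ) =
          ((χ (modNCyclotomicCharacter ℚ (4 * n) τ : ZMod (4 * n)) : ℤ) : AlgebraicClosure ℚ) *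
            geomSqrt ((-((-1 : ℤ) ^ (n / 2) * n) : ℤ) : ℚ) := by
  haveI : Fact (Nat.Prime 3) := ⟨Nat.prime_three⟩
  obtain ⟨χb, sb, hqb, hpb, hvb, -, hsb2, hτb⟩ :=
    EisensteinPrimesMazurMCOnCellBTwistbackQuadraticRadical.exists_quadraticChar_radical (p := 3) (by decide) n hn hsq
  obtain ⟨s₁, -, hs₁2, hτ₁⟩ := Rat.exists_sqrt_neg_one_smul_eq_chi4
  have hcop : (4 : ℕ).Coprime n := by
    have h2 : Nat.Coprime 2 n :=
      (Nat.Prime.coprime_iff_not_dvd Nat.prime_two).mpr (Nat.two_dvd_ne_zero.mpr (Nat.odd_iff.mp hn))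
    have : (4 : ℕ) = 2 ^ 2 := by norm_num
    rw [this]; exact Nat.Coprime.pow_left 2 h2
  refine ⟨changeLevel (dvd_mul_right 4 n) ZMod.χ₄ * changeLevel (dvd_mul_left n 4) χb,
    (ZMod.isQuadratic_χ₄.changeLevel_int _).mul_int (hqb.changeLevel_int _), ?_, fun a ↦ ?_, fun τ ↦ ?_⟩
  · rw [MulChar.ringHomComp_mul, DirichletCharacter.ringHomComp_changeLevel,
      DirichletCharacter.ringHomComp_changeLevel]
    exact isPrimitive_changeLevel_mul_changeLevel chi4_three_isPrimitive hpb hcop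
  · rw [changeLevel_mul_changeLevel_apply_natCast, hvb]
  · -- the radical `s₁ · sb` squares to `−n*`
    have hprod := Rat.smul_mul_eq_changeLevel_mul (dvd_mul_right 4 n) (dvd_mul_left n 4) ZMod.χ₄ χb hτ₁ hτb
    refine smul_geomSqrt_of_sq_eq ?_ hprod τ
    rw [mul_pow, hs₁2, hsb2, geomSqrt_sq, map_intCast]
    push_cast
    ring

/-- **Quadratic Kronecker–Weber for `√(2n*)`, `n` odd squarefree** (`2n*` runs over the squarefree integers `2D′` with
`D′ ≡ 1 (mod 4)`, field discriminant `8D′`; `n = 1` is `√2`): a quadratic `ℤ`-valued character `χ` modulo `8n` —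
`χ(a) = χ₈(a)·J(a | n)` — with PRIMITIVE reduction modulo `3` and `τ • √(2n*) = χ(χ_{8n}(τ)) • √(2n*)`. `√2 = ζ₈ + ζ₈⁻¹`
with `χ₈` (X3 cell's `Rat.exists_sqrt_two_smul_eq_chi8`, `chi8_three_isPrimitive`) times the Jacobi radical of `√(n*)`.
[cite: Washington1997, Ch. 2 and Ch. 3] [cite: IrelandRosen1990, Ch. 6 Prop. 6.3.2] -/
theorem exists_quadraticChar_geomSqrt_two_mul_star {n : ℕ} [NeZero n] (hn : Odd n) (hsq : Squarefree n) :
    ∃ χ : MulChar (ZMod (8 * n)) ℤ, χ.IsQuadratic ∧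
      DirichletCharacter.IsPrimitive
        (χ.ringHomComp (Int.castRingHom (ZMod 3)) : DirichletCharacter (ZMod 3) (8 * n)) ∧
      (∀ a : ℕ, χ (a : ZMod (8 * n)) = ZMod.χ₈ (a : ZMod 8) * J((a : ℤ) | n)) ∧
      ∀ τ : absoluteGaloisGroup ℚ,
        τ • geomSqrt ((2 * ((-1 : ℤ) ^ (n / 2) * n) : ℤ) : ℚ) =
          ((χ (modNCyclotomicCharacter ℚ (8 * n) τ : ZMod (8 * n)) : ℤ) : AlgebraicClosure ℚ) *
            geomSqrt ((2 * ((-1 : ℤ) ^ (n / 2) * n) : ℤ) : ℚ) := by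
  haveI : Fact (Nat.Prime 3) := ⟨Nat.prime_three⟩
  obtain ⟨χb, sb, hqb, hpb, hvb, -, hsb2, hτb⟩ :=
    EisensteinPrimesMazurMCOnCellBTwistbackQuadraticRadical.exists_quadraticChar_radical (p := 3) (by decide) n hn hsq
  obtain ⟨s₂, -, hs₂2, hτ₂⟩ := Rat.exists_sqrt_two_smul_eq_chi8
  have hcop : (8 : ℕ).Coprime n := by
    have h2 : Nat.Coprime 2 n :=
      (Nat.Prime.coprime_iff_not_dvd Nat.prime_two).mpr (Nat.two_dvd_ne_zero.mpr (Nat.odd_iff.mp hn))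
    have : (8 : ℕ) = 2 ^ 3 := by norm_num
    rw [this]; exact Nat.Coprime.pow_left 3 h2
  refine ⟨changeLevel (dvd_mul_right 8 n) ZMod.χ₈ * changeLevel (dvd_mul_left n 8) χb,
    (ZMod.isQuadratic_χ₈.changeLevel_int _).mul_int (hqb.changeLevel_int _), ?_, fun a ↦ ?_, fun τ ↦ ?_⟩
  · rw [MulChar.ringHomComp_mul, DirichletCharacter.ringHomComp_changeLevel,
      DirichletCharacter.ringHomComp_changeLevel]
    exact isPrimitive_changeLevel_mul_changeLevel chi8_three_isPrimitive hpb hcop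
  · rw [changeLevel_mul_changeLevel_apply_natCast, hvb]
  · have hprod := Rat.smul_mul_eq_changeLevel_mul (dvd_mul_right 8 n) (dvd_mul_left n 8) ZMod.χ₈ χb hτ₂ hτb
    refine smul_geomSqrt_of_sq_eq ?_ hprod τ
    rw [mul_pow, hs₂2, hsb2, geomSqrt_sq, map_intCast]
    push_cast
    ring

/-! ## §2. The character-free doors for these kernel discriminants -/

/-- **Stub 6 (∃-PARTNER) at a non-split X2b pair `(W, 3)`, character-free, kernel discriminant `D = −n* ≡ 3 (mod 4)`**
(`n` odd squarefree, field `ℚ(√D)` of discriminant `4D`; the A10 cells with `d_unr ∈ {11, 23}`: `n = 11, 23`). Part 3's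
`upperPartner_at_three_of_kernelRadical_of_padicGZ` fed with §1's character: data = `Φ₀` (rational `3`-line), `n` with
«`σ` fixes `Φ₀` pointwise iff `σ√(−n*) = √(−n*)`», `S₀ ⊇ A` with reduction types, and the decidable identity with level `4n`
and indicator `[χ₄(ℓ)·J(ℓ | n) = 1]`. PUBLISHED named facts
only; conditional. [cite: GreenbergVatsal2000, §2 Prop. (2.4), p. 28, §3 Thm. (3.11) and p. 43]
[cite: Disegni2020, §2.2 Thm. 2.4 and §3.2 Thm. 4] [cite: NakagawaHorie1988, Thm. 1] [cite: Cox2013, §1.C Lemma 1.14] -/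
theorem upperPartner_at_three_of_kernelDisc_three_mod_four_of_padicGZ (hP : EisensteinPrimes.PublishedInputs)
    (hDis : padicBSD_rankOne_nonsplitMult) (h311 : thm311_hasUnitContent_iff_and_order_eq_of_lineRamifiedEven)
    (hDGZ : padicGrossZagier_nonsplitMult)
    (hNH : Literature.NumberTheory.QuadraticFields.nakagawaHorie_taya_exists_imaginary_h3_eq_one)
    (W : WeierstrassCurve ℚ) [W.IsElliptic] [W.IsGloballyMinimal]
    (hc : X2.CellB W 3) (hns : ¬ W.HasSplitMultiplicativeReductionAtPrime 3)
    {Φ₀ : AddSubgroup (geomTorsion W (3 : ℤ))} (hΦ : IsRationalLine W 3 Φ₀)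
    {n : ℕ} [NeZero n] (hn : Odd n) (hsq : Squarefree n)
    (hker : ∀ σ : absoluteGaloisGroup ℚ,
      (∀ Q ∈ Φ₀, σ • Q = Q) ↔ σ • geomSqrt ((-((-1 : ℤ) ^ (n / 2) * n) : ℤ) : ℚ) =
        geomSqrt ((-((-1 : ℤ) ^ (n / 2) * n) : ℤ) : ℚ))
    (S₀ : Finset (HeightOneSpectrum (𝓞 ℚ))) (hS₀p : ∀ v ∈ S₀, ((3 : ℕ) : 𝓞 ℚ) ∉ v.asIdeal)
    (hS : ∀ v : HeightOneSpectrum (𝓞 ℚ), v ∉ S₀ → ((3 : ℕ) : 𝓞 ℚ) ∉ v.asIdeal → W.HasGoodReductionAt v)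
    (A : Finset (HeightOneSpectrum (𝓞 ℚ))) (hAS : A ⊆ S₀) (hA : ∀ v ∈ A, W.HasAdditiveReductionAt v)
    (hmult : ∀ v ∈ S₀, v ∉ A → W.HasMultiplicativeReductionAt v)
    (hbal : 1 = ∑ v ∈ S₀ \ A, (if W.HasSplitMultiplicativeReductionAt v
          then sFactor 3 (Rat.HeightOneSpectrum.natGenerator v) else 0) +
      ∑ v ∈ A, (if Rat.HeightOneSpectrum.natGenerator v ∣ 4 * n then 0 else
        if Rat.HeightOneSpectrum.natGenerator v % 3 = 2 then sFactor 3 (Rat.HeightOneSpectrum.natGenerator v)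
        else 2 * (if ZMod.χ₄ (Rat.HeightOneSpectrum.natGenerator v : ZMod 4) *
            J((Rat.HeightOneSpectrum.natGenerator v : ℤ) | n) = 1
          then sFactor 3 (Rat.HeightOneSpectrum.natGenerator v) else 0))) :
    ∃ (K : Type) (_ : Field K) (_ : NumberField K), IsImaginaryQuadratic K ∧
      SatisfiesHeegnerHypothesis (W.conductorNorm ℤ) K ∧ SatisfiesHeegnerHypothesis 3 K ∧
      Odd (NumberField.discr K) ∧ NumberField.discr K < -4 ∧
      (W.quadraticTwist (NumberField.discr K : ℚ)).analyticRank = 1 ∧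
      ∀ (Wd : WeierstrassCurve ℚ) [Wd.IsElliptic] [Wd.IsGloballyMinimal],
        (∃ C : VariableChange ℚ, C • Wd = W.quadraticTwist (NumberField.discr K : ℚ)) →
        MissingUpperBoundAt Wd 3 := by
  haveI : NeZero (4 * n) := ⟨mul_ne_zero (by norm_num) (NeZero.ne _)⟩
  obtain ⟨χ, hχ2, hprim, hval, hrad⟩ := exists_quadraticChar_geomSqrt_neg_star hn hsq
  have hD0 : ((-((-1 : ℤ) ^ (n / 2) * n) : ℤ) : ℚ) ≠ 0 := by
    have hn0 : (n : ℤ) ≠ 0 := by exact_mod_cast NeZero.ne n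
    have : (-((-1 : ℤ) ^ (n / 2) * n) : ℤ) ≠ 0 :=
      neg_ne_zero.mpr (mul_ne_zero (pow_ne_zero _ (by norm_num)) hn0)
    exact_mod_cast this
  refine EisensteinPrimesMazurMCOnCellBTwistbackSubrowLineCharBalance.upperPartner_at_three_of_kernelRadical_of_padicGZ
    hP hDis h311 hDGZ hNH W hc hns hΦ χ hχ2 hprim (geomSqrt_ne_zero hD0) hrad hker S₀ hS₀p hS A hAS hA hmult ?_
  rw [hbal]
  congr 1
  refine Finset.sum_congr rfl fun v _ ↦ ?_
  rw [hval]

/-- **Stub 6 (∃-PARTNER) at a non-split X2b pair `(W, 3)`, character-free, kernel discriminant `D = 2n*`** (`n` odd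
squarefree, field `ℚ(√D)` of discriminant `4D`; `n = 1`, `D = 2` covers the 13 A10 non-split cells with `d_unr = 2`, e.g.
lam-a g16's display pair `(5568g1, 3)`): as the previous door with level `8n` and indicator `[χ₈(ℓ)·J(ℓ | n) = 1]`.
PUBLISHED named facts only; conditional. [cite: GreenbergVatsal2000, §2 Prop. (2.4), p. 28, §3 Thm. (3.11) and p. 43]
[cite: Disegni2020, §2.2 Thm. 2.4 and §3.2 Thm. 4] [cite: NakagawaHorie1988, Thm. 1] [cite: Washington1997, Ch. 2] -/
theorem upperPartner_at_three_of_kernelDisc_two_mul_of_padicGZ (hP : EisensteinPrimes.PublishedInputs)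
    (hDis : padicBSD_rankOne_nonsplitMult) (h311 : thm311_hasUnitContent_iff_and_order_eq_of_lineRamifiedEven)
    (hDGZ : padicGrossZagier_nonsplitMult)
    (hNH : Literature.NumberTheory.QuadraticFields.nakagawaHorie_taya_exists_imaginary_h3_eq_one)
    (W : WeierstrassCurve ℚ) [W.IsElliptic] [W.IsGloballyMinimal]
    (hc : X2.CellB W 3) (hns : ¬ W.HasSplitMultiplicativeReductionAtPrime 3)
    {Φ₀ : AddSubgroup (geomTorsion W (3 : ℤ))} (hΦ : IsRationalLine W 3 Φ₀)
    {n : ℕ} [NeZero n] (hn : Odd n) (hsq : Squarefree n)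
    (hker : ∀ σ : absoluteGaloisGroup ℚ,
      (∀ Q ∈ Φ₀, σ • Q = Q) ↔ σ • geomSqrt ((2 * ((-1 : ℤ) ^ (n / 2) * n) : ℤ) : ℚ) =
        geomSqrt ((2 * ((-1 : ℤ) ^ (n / 2) * n) : ℤ) : ℚ))
    (S₀ : Finset (HeightOneSpectrum (𝓞 ℚ))) (hS₀p : ∀ v ∈ S₀, ((3 : ℕ) : 𝓞 ℚ) ∉ v.asIdeal)
    (hS : ∀ v : HeightOneSpectrum (𝓞 ℚ), v ∉ S₀ → ((3 : ℕ) : 𝓞 ℚ) ∉ v.asIdeal → W.HasGoodReductionAt v)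
    (A : Finset (HeightOneSpectrum (𝓞 ℚ))) (hAS : A ⊆ S₀) (hA : ∀ v ∈ A, W.HasAdditiveReductionAt v)
    (hmult : ∀ v ∈ S₀, v ∉ A → W.HasMultiplicativeReductionAt v)
    (hbal : 1 = ∑ v ∈ S₀ \ A, (if W.HasSplitMultiplicativeReductionAt v
          then sFactor 3 (Rat.HeightOneSpectrum.natGenerator v) else 0) +
      ∑ v ∈ A, (if Rat.HeightOneSpectrum.natGenerator v ∣ 8 * n then 0 else
        if Rat.HeightOneSpectrum.natGenerator v % 3 = 2 then sFactor 3 (Rat.HeightOneSpectrum.natGenerator v)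
        else 2 * (if ZMod.χ₈ (Rat.HeightOneSpectrum.natGenerator v : ZMod 8) *
            J((Rat.HeightOneSpectrum.natGenerator v : ℤ) | n) = 1
          then sFactor 3 (Rat.HeightOneSpectrum.natGenerator v) else 0))) :
    ∃ (K : Type) (_ : Field K) (_ : NumberField K), IsImaginaryQuadratic K ∧
      SatisfiesHeegnerHypothesis (W.conductorNorm ℤ) K ∧ SatisfiesHeegnerHypothesis 3 K ∧
      Odd (NumberField.discr K) ∧ NumberField.discr K < -4 ∧
      (W.quadraticTwist (NumberField.discr K : ℚ)).analyticRank = 1 ∧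
      ∀ (Wd : WeierstrassCurve ℚ) [Wd.IsElliptic] [Wd.IsGloballyMinimal],
        (∃ C : VariableChange ℚ, C • Wd = W.quadraticTwist (NumberField.discr K : ℚ)) →
        MissingUpperBoundAt Wd 3 := by
  haveI : NeZero (8 * n) := ⟨mul_ne_zero (by norm_num) (NeZero.ne _)⟩
  obtain ⟨χ, hχ2, hprim, hval, hrad⟩ := exists_quadraticChar_geomSqrt_two_mul_star hn hsq
  have hD0 : ((2 * ((-1 : ℤ) ^ (n / 2) * n) : ℤ) : ℚ) ≠ 0 := by
    have hn0 : (n : ℤ) ≠ 0 := by exact_mod_cast NeZero.ne n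
    have : (2 * ((-1 : ℤ) ^ (n / 2) * n) : ℤ) ≠ 0 :=
      mul_ne_zero two_ne_zero (mul_ne_zero (pow_ne_zero _ (by norm_num)) hn0)
    exact_mod_cast this
  refine EisensteinPrimesMazurMCOnCellBTwistbackSubrowLineCharBalance.upperPartner_at_three_of_kernelRadical_of_padicGZ
    hP hDis h311 hDGZ hNH W hc hns hΦ χ hχ2 hprim (geomSqrt_ne_zero hD0) hrad hker S₀ hS₀p hS A hAS hA hmult ?_
  rw [hbal]
  congr 1
  refine Finset.sum_congr rfl fun v _ ↦ ?_
  rw [hval]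

end Summit.BirchSwinnertonDyer.BirchSwinnertonDyer.Theorems.EisensteinPrimesMazurMCOnCellBTwistbackSubrowKernelDiscEven

end
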